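import Literature.NumberTheory.Sieve.GoldbachLinnikAssembly
import Literature.NumberTheory.Sieve.GoldbachLinnikCentralArc
import Literature.NumberTheory.Sieve.RamanujanSum
import Literature.NumberTheory.Sieve.SiftedLargeSieveCharacters
import Mathlib.NumberTheory.Harmonic.Bounds
import HarnessLib

/-!
# Goldbach–Linnik numbers: the mass of `|S|²` on the major arcs (Pintz–Ruzsa I, (8.20)–(8.21)),
unconditionally and by positivity

Topic `Literature/NumberTheory/Sieve`; support file for the named fact
`Literature.NumberTheory.Sieve.goldbach_linnik` (parity.S36). Sequel to `GoldbachLinnikCentralArc.lean`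
and `GoldbachLinnikAssembly.lean` (`periodicArcs P Q` = Pintz–Ruzsa's arcs (2.2)–(2.3) read on `[0,1]`).

Pintz–Ruzsa I, §8 (8.20)–(8.21): the term `L R₂(0) = L (π₂(N) - ∫_𝔐 |S|²)` of (8.17) is
`∼ (1 - log P/log N) L N/log N`, because `∫_𝔐 |S|² ∼ (N/log² N) ∑_{q ≤ P} μ²(q)/φ(q) ∼ (log P/log N) N/log N`
(there under GRH with `P = √N/L⁸`, via (2.5); in Part II unconditionally). For the LOWER bound on
`∫_𝔐 |S|²` — which is all that (8.21) uses — no distribution of primes in progressions is needed: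
for square-free `q`, `∑_{(a,q)=1} S(a/q + β) = μ(q) S(β) + O(ω(q) φ(q))` (Ramanujan sums
`c_q(p) = μ(q)` for `p ∤ q`), so by positivity (`|S_a - M|² ≥ 0` with `M = (μ(q)/φ(q)) S(β)`)

  `∑_{(a,q)=1} ∫_{|β| ≤ r} |S(a/q + β)|² ≥ (1/φ(q)) ∫_{|β| ≤ r} |S(β)|² - 8 ω(q) (N+1) r`

(`sum_coprime_setIntegral_normSq_translate_ge`); summing over the disjoint arcs `q ≤ P₁`,
`r = 1/(qQ) ≥ log³ N/N`, and inserting the central-arc mass `∫_{|β| ≤ log³N/N} |S|² ≥ (1-ε)N/log² N`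
(`GoldbachLinnikCentralArc`) and `∑_{q ≤ x} μ²(q)/φ(q) ≥ log x` (tree:
`log_le_mul_sum_inv_totient`) gives the **main result** (`eventually_card_oddPrimes_sub_majorArcPairIntegral_le`):
for Pintz–Ruzsa's arcs at levels `N^θ ≤ P(N)`, `N^θ ≤ Q(N) ≤ N^{1-θ}` (`0 < θ`), for every `ε > 0`
and all large `N`,

  `π₂(N) - ∫_{[0,1] ∩ 𝔐_N} |S|² ≤ (1 - θ + ε) N/log N`,

i.e. the hypothesis `hM0` (with this `θ`) of `GoldbachLinnik.minor_meanSquare_le_four` and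
`GoldbachLinnik.goldbach_linnik_of_majorArcs_largeDeviations` (`GoldbachLinnikMinorMeanSquare.lean`),
DISCHARGED. Everything here is proved; no definitions and no named facts are introduced.

## References

* J. Pintz, I. Z. Ruzsa, *On Linnik's approximation to Goldbach's problem, I*, Acta Arith. 109
  (2003) 169–194, §2 (2.2)–(2.3), §8 (8.17)–(8.21). [PintzRuzsa2003]
* H. L. Montgomery, R. C. Vaughan, *Multiplicative Number Theory I*, CUP 2007, Thm 4.1 (Ramanujan
  sums), and §3 (2.?) `∑_{q ≤ x} μ²(q)/φ(q) ≥ log x`. [MontgomeryVaughan2007]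
-/

noncomputable section

open scoped FourierTransform Topology Real ArithmeticFunction.Moebius ArithmeticFunction.omega

open Finset Filter MeasureTheory

namespace Literature.NumberTheory.Sieve

namespace GoldbachLinnik

/-! ### Ramanujan sums over the reduced residues `1 ≤ a ≤ q` -/

/-- For `q ≥ 2` the reduced residues `1 ≤ a ≤ q` and `0 ≤ a < q` coincide. [folklore] -/
theorem filter_coprime_Icc_eq_range {q : ℕ} (hq : 2 ≤ q) :
    (Icc 1 q).filter (fun a => a.Coprime q) = (range q).filter (fun a => a.Coprime q) := by
  ext a
  simp only [mem_filter, mem_Icc, mem_range]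
  constructor
  · rintro ⟨⟨-, haq⟩, hc⟩
    refine ⟨lt_of_le_of_ne haq ?_, hc⟩
    rintro rfl
    rw [Nat.coprime_self] at hc
    omega
  · rintro ⟨hlt, hc⟩
    refine ⟨⟨?_, hlt.le⟩, hc⟩
    by_contra h0
    have : a = 0 := by omega
    rw [this, Nat.coprime_zero_left] at hc
    omega

/-- There are `φ(q)` reduced residues `1 ≤ a ≤ q` (`q ≥ 2`). [folklore] -/
theorem card_filter_coprime_Icc {q : ℕ} (hq : 2 ≤ q) :
    ((Icc 1 q).filter (fun a => a.Coprime q)).card = q.totient := by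
  rw [filter_coprime_Icc_eq_range hq, Nat.totient_eq_card_coprime,
    filter_congr (fun a _ => Nat.coprime_comm)]

/-- `c_q(h) = μ(q)` for `(h, q) = 1` (Kluyver: only `d = 1` divides `(q, h)`).
[cite: MontgomeryVaughan2007, Thm 4.1 eq. (4.7)] -/
theorem ramanujanSum_eq_moebius_of_coprime {q h : ℕ} (hq : q ≠ 0) (hc : h.Coprime q) :
    ramanujanSum q h = (μ q : ℂ) := by
  have key : ramanujanDivisorSum h q = μ q := by
    rw [ramanujanDivisorSum_apply,
      Nat.sum_divisorsAntidiagonal' (fun x y => (μ x : ℤ) * (if y ∣ h then (y : ℤ) else 0)),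
      Finset.sum_eq_single 1]
    · simp
    · intro y hy hy1
      rw [Nat.mem_divisors] at hy
      have hyh : ¬ y ∣ h := fun hyh => hy1 ((Nat.Coprime.coprime_dvd_left hyh hc).eq_one_of_dvd hy.1)
      rw [if_neg hyh, mul_zero]
    · intro h1
      exact absurd (Nat.one_mem_divisors.2 hq) h1
  rw [ramanujanSum_eq_ramanujanDivisorSum, Int.natAbs_natCast, key]

/-- **The key identity**: `∑_{1 ≤ a ≤ q, (a,q)=1} S(a/q + β) = ∑_{p} c_q(p) e(pβ)` (exchange the sums).
[cite: MontgomeryVaughan2007, Thm 4.1] -/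
theorem sum_coprime_primeSum_translate {q : ℕ} (hq : 2 ≤ q) (N : ℕ) (β : ℝ) :
    ∑ a ∈ (Icc 1 q).filter (fun a => a.Coprime q), primeSum N ((a : ℝ) / q + β) =
      ∑ p ∈ oddPrimes N, ramanujanSum q p * (𝐞 ((p : ℝ) * β) : ℂ) := by
  rw [filter_coprime_Icc_eq_range hq]
  unfold primeSum
  rw [Finset.sum_comm]
  refine Finset.sum_congr rfl fun p _ => ?_
  rw [ramanujanSum, Finset.sum_mul]
  refine Finset.sum_congr rfl fun a _ => ?_
  rw [← fourierChar_add_coe]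
  congr 2
  push_cast
  ring

/-- `∑_{(a,q)=1} S(a/q + β) = μ(q) S(β) + O(ω(q)(φ(q)+1))`: the primes `p ∤ q` contribute
`c_q(p) = μ(q)`, and the at most `ω(q)` primes `p ∣ q` have `|c_q(p)|, |μ(q)| ≤ φ(q), 1`.
[cite: MontgomeryVaughan2007, Thm 4.1] -/
theorem norm_sum_coprime_primeSum_translate_sub_le {q : ℕ} (hq : 2 ≤ q) (N : ℕ) (β : ℝ) :
    ‖∑ a ∈ (Icc 1 q).filter (fun a => a.Coprime q), primeSum N ((a : ℝ) / q + β) -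
        (μ q : ℂ) * primeSum N β‖ ≤ q.primeFactors.card * (q.totient + 1) := by
  have hq0 : q ≠ 0 := by omega
  rw [sum_coprime_primeSum_translate hq, primeSum, Finset.mul_sum, ← Finset.sum_sub_distrib,
    ← Finset.sum_filter_add_sum_filter_not (oddPrimes N) (fun p => p ∣ q)]
  have hvan : ∑ p ∈ (oddPrimes N).filter (fun p => ¬ p ∣ q),
      (ramanujanSum q p * (𝐞 ((p : ℝ) * β) : ℂ) - (μ q : ℂ) * (𝐞 ((p : ℝ) * β) : ℂ)) = 0 := by
    refine Finset.sum_eq_zero fun p hp => ?_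
    rw [mem_filter, mem_oddPrimes] at hp
    have hcop : p.Coprime q := (Nat.Prime.coprime_iff_not_dvd hp.1.2.1).2 hp.2
    rw [ramanujanSum_eq_moebius_of_coprime hq0 hcop, sub_self]
  rw [hvan, add_zero]
  refine (norm_sum_le _ _).trans ?_
  have hμ : ‖(μ q : ℂ)‖ ≤ 1 := by
    rw [Complex.norm_intCast]
    exact_mod_cast ArithmeticFunction.abs_moebius_le_one
  have hterm : ∀ p ∈ (oddPrimes N).filter (fun p => p ∣ q),
      ‖ramanujanSum q p * (𝐞 ((p : ℝ) * β) : ℂ) - (μ q : ℂ) * (𝐞 ((p : ℝ) * β) : ℂ)‖ ≤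
        q.totient + 1 := by
    intro p _
    refine (norm_sub_le _ _).trans (add_le_add ?_ ?_)
    · rw [norm_mul, Circle.norm_coe, mul_one]; exact norm_ramanujanSum_le_totient q p
    · rw [norm_mul, Circle.norm_coe, mul_one]; exact hμ
  refine (Finset.sum_le_sum hterm).trans ?_
  rw [Finset.sum_const, nsmul_eq_mul]
  refine mul_le_mul_of_nonneg_right ?_ (by positivity)
  have : ((oddPrimes N).filter (fun p => p ∣ q)).card ≤ q.primeFactors.card := by
    refine Finset.card_le_card fun p hp => ?_
    rw [mem_filter, mem_oddPrimes] at hp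
    exact Nat.mem_primeFactors.2 ⟨hp.1.2.1, hp.2, hq0⟩
  exact_mod_cast this

/-! ### Positivity: `∑_a |S(a/q+β)|² ≥ |S(β)|²/φ(q) - 4ω(q)(N+1)` -/

/-- `|z|² ≥ 2 Re(z w̄) - |w|²` (`= |z - w|² ≥ 0` rearranged). [folklore] -/
theorem two_mul_re_mul_conj_sub_le (z w : ℂ) :
    2 * (z * (starRingEnd ℂ) w).re - ‖w‖ ^ 2 ≤ ‖z‖ ^ 2 := by
  have h := Complex.normSq_nonneg (z - w)
  rw [Complex.normSq_sub] at h
  rw [← Complex.normSq_eq_norm_sq, ← Complex.normSq_eq_norm_sq]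
  linarith

/-- The trivial bound `|S(β)| ≤ N + 1`. [folklore] -/
theorem norm_primeSum_le_succ (N : ℕ) (β : ℝ) : ‖primeSum N β‖ ≤ N + 1 := by
  unfold primeSum
  refine (norm_sum_le _ _).trans ?_
  simp only [Circle.norm_coe, Finset.sum_const, nsmul_eq_mul, mul_one]
  have : (oddPrimes N).card ≤ N + 1 := by
    calc (oddPrimes N).card ≤ (range (N + 1)).card := card_le_card (Finset.filter_subset _ _)
      _ = N + 1 := card_range _
  exact_mod_cast this

/-- **Positivity at a point**: for square-free `q ≥ 2` and every `β`,
`∑_{(a,q)=1} |S(a/q + β)|² ≥ |S(β)|²/φ(q) - 4 ω(q) (N + 1)`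
(from `∑_a |S_a - M|² ≥ 0` with `M = (μ(q)/φ(q)) S(β)` and the key identity).
[cite: PintzRuzsa2003, §8 (8.20) (lower bound, by positivity)] -/
theorem sum_coprime_normSq_primeSum_translate_ge {q : ℕ} (hq : 2 ≤ q) (hsq : Squarefree q)
    (N : ℕ) (β : ℝ) :
    ‖primeSum N β‖ ^ 2 / q.totient - 4 * q.primeFactors.card * (N + 1) ≤
      ∑ a ∈ (Icc 1 q).filter (fun a => a.Coprime q), ‖primeSum N ((a : ℝ) / q + β)‖ ^ 2 := by
  set A := (Icc 1 q).filter (fun a => a.Coprime q) with hA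
  set S : ℂ := primeSum N β with hS
  set φr : ℝ := (q.totient : ℝ) with hφ
  have hφ1 : 1 ≤ φr := by
    simp only [hφ]; exact_mod_cast Nat.totient_pos.2 (by omega)
  have hφ0 : 0 < φr := by linarith
  set m : ℝ := (μ q : ℝ) with hm
  have hm2 : m ^ 2 = 1 := by
    simp only [hm]
    rw [ArithmeticFunction.moebius_apply_of_squarefree hsq]
    push_cast
    rw [← pow_mul, mul_comm, pow_mul]
    norm_num
  have hmabs : |m| = 1 := by
    have : |m| ^ 2 = 1 := by rw [sq_abs, hm2]
    nlinarith [abs_nonneg m]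
  set c : ℝ := m / φr with hc
  set M : ℂ := (c : ℂ) * S with hM
  -- the correction `R`
  set R : ℂ := ∑ a ∈ A, primeSum N ((a : ℝ) / q + β) - (μ q : ℂ) * S with hR
  have hRle : ‖R‖ ≤ q.primeFactors.card * (φr + 1) := by
    simp only [hR, hφ]; exact norm_sum_coprime_primeSum_translate_sub_le hq N β
  have hsum : ∑ a ∈ A, primeSum N ((a : ℝ) / q + β) = (m : ℂ) * S + R := by
    simp only [hR, hm]; push_cast; ring
  -- pointwise positivity, summed over `a`
  have hpos : ∑ a ∈ A, (2 * (primeSum N ((a : ℝ) / q + β) * (starRingEnd ℂ) M).re - ‖M‖ ^ 2) ≤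
      ∑ a ∈ A, ‖primeSum N ((a : ℝ) / q + β)‖ ^ 2 :=
    Finset.sum_le_sum fun a _ => two_mul_re_mul_conj_sub_le _ _
  have hcard : (A.card : ℝ) = φr := by simp only [hA, hφ]; exact_mod_cast card_filter_coprime_Icc hq
  have hlhs : ∑ a ∈ A, (2 * (primeSum N ((a : ℝ) / q + β) * (starRingEnd ℂ) M).re - ‖M‖ ^ 2) =
      2 * (((m : ℂ) * S + R) * (starRingEnd ℂ) M).re - φr * ‖M‖ ^ 2 := by
    rw [Finset.sum_sub_distrib, Finset.sum_const, nsmul_eq_mul, hcard, ← Finset.mul_sum,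
      ← Complex.re_sum, ← Finset.sum_mul, hsum]
  -- evaluate the two terms
  have hconjM : (starRingEnd ℂ) M = (c : ℂ) * (starRingEnd ℂ) S := by
    simp only [hM, map_mul, Complex.conj_ofReal]
  have hSS : S * (starRingEnd ℂ) S = ((‖S‖ ^ 2 : ℝ) : ℂ) := by
    rw [Complex.mul_conj, Complex.normSq_eq_norm_sq]
  have hmain : (((m : ℂ) * S + R) * (starRingEnd ℂ) M).re = c * m * ‖S‖ ^ 2 + c * (R * (starRingEnd ℂ) S).re := by
    rw [hconjM, add_mul, Complex.add_re]
    have h1 : (m : ℂ) * S * ((c : ℂ) * (starRingEnd ℂ) S) = ((c * m * ‖S‖ ^ 2 : ℝ) : ℂ) := by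
      rw [show (m : ℂ) * S * ((c : ℂ) * (starRingEnd ℂ) S) = (c : ℂ) * (m : ℂ) * (S * (starRingEnd ℂ) S) by ring,
        hSS]; push_cast; ring
    have h2 : R * ((c : ℂ) * (starRingEnd ℂ) S) = (c : ℂ) * (R * (starRingEnd ℂ) S) := by ring
    rw [h1, h2, Complex.ofReal_re, Complex.re_ofReal_mul]
  have hnormM : ‖M‖ ^ 2 = c ^ 2 * ‖S‖ ^ 2 := by
    simp only [hM]; rw [norm_mul, Complex.norm_real, Real.norm_eq_abs, mul_pow, sq_abs]
  have hφne : φr ≠ 0 := hφ0.ne'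
  have hcm : c * m = 1 / φr := by rw [hc, div_mul_eq_mul_div, ← sq, hm2]
  have hc2 : φr * c ^ 2 = 1 / φr := by
    rw [hc, div_pow, hm2]; field_simp
  have hRre : |c * (R * (starRingEnd ℂ) S).re| ≤ (1 / φr) * (q.primeFactors.card * (φr + 1)) * ‖S‖ := by
    rw [abs_mul]
    have hcabs : |c| = 1 / φr := by simp only [hc]; rw [abs_div, hmabs, abs_of_pos hφ0]
    rw [hcabs, mul_assoc]
    refine mul_le_mul_of_nonneg_left ?_ (by positivity)
    calc |(R * (starRingEnd ℂ) S).re| ≤ ‖R * (starRingEnd ℂ) S‖ := Complex.abs_re_le_norm _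
      _ = ‖R‖ * ‖S‖ := by rw [norm_mul, Complex.norm_conj]
      _ ≤ (q.primeFactors.card * (φr + 1)) * ‖S‖ := mul_le_mul_of_nonneg_right hRle (norm_nonneg _)
  -- assemble
  have hSle : ‖S‖ ≤ N + 1 := norm_primeSum_le_succ N β
  have hkey : ‖S‖ ^ 2 / φr - 4 * q.primeFactors.card * (N + 1) ≤
      2 * (((m : ℂ) * S + R) * (starRingEnd ℂ) M).re - φr * ‖M‖ ^ 2 := by
    rw [hmain, hnormM]
    have hω0 : (0 : ℝ) ≤ q.primeFactors.card := Nat.cast_nonneg _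
    have h3 := (abs_le.1 hRre).1
    -- `2/φ (φ+1) ≤ 4`
    have hfrac : (1 / φr) * (φr + 1) ≤ 2 := by
      rw [div_mul_eq_mul_div, one_mul, div_le_iff₀ hφ0]; linarith
    have h4 : (1 / φr) * (q.primeFactors.card * (φr + 1)) * ‖S‖ ≤ 2 * q.primeFactors.card * (N + 1) := by
      calc (1 / φr) * (q.primeFactors.card * (φr + 1)) * ‖S‖
          = q.primeFactors.card * ((1 / φr) * (φr + 1)) * ‖S‖ := by ring
        _ ≤ q.primeFactors.card * 2 * (N + 1) := by
            exact mul_le_mul (mul_le_mul_of_nonneg_left hfrac hω0) hSle (norm_nonneg _)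
              (mul_nonneg hω0 zero_le_two)
        _ = 2 * q.primeFactors.card * (N + 1) := by ring
    have : 2 * (c * m * ‖S‖ ^ 2 + c * (R * (starRingEnd ℂ) S).re) - φr * (c ^ 2 * ‖S‖ ^ 2) =
        (2 * (c * m) - φr * c ^ 2) * ‖S‖ ^ 2 + 2 * (c * (R * (starRingEnd ℂ) S).re) := by ring
    rw [this, hcm, hc2]
    have : (2 * (1 / φr) - 1 / φr) * ‖S‖ ^ 2 = ‖S‖ ^ 2 / φr := by ring
    rw [this]
    linarith
  calc ‖S‖ ^ 2 / φr - 4 * q.primeFactors.card * (N + 1)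
      ≤ 2 * (((m : ℂ) * S + R) * (starRingEnd ℂ) M).re - φr * ‖M‖ ^ 2 := hkey
    _ = ∑ a ∈ A, (2 * (primeSum N ((a : ℝ) / q + β) * (starRingEnd ℂ) M).re - ‖M‖ ^ 2) := hlhs.symm
    _ ≤ ∑ a ∈ A, ‖primeSum N ((a : ℝ) / q + β)‖ ^ 2 := hpos

/-- **Positivity, integrated**: for square-free `q ≥ 2` and `r > 0`,
`∑_{(a,q)=1} ∫_{|β| ≤ r} |S(a/q + β)|² ≥ (1/φ(q)) ∫_{|β| ≤ r} |S(β)|² - 8 ω(q) (N+1) r`.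
[cite: PintzRuzsa2003, §8 (8.20) (lower bound, by positivity)] -/
theorem sum_coprime_setIntegral_normSq_translate_ge {q : ℕ} (hq : 2 ≤ q) (hsq : Squarefree q)
    (N : ℕ) {r : ℝ} (hr : 0 < r) :
    (∫ β in Set.Icc (-r) r, ‖primeSum N β‖ ^ 2) / q.totient -
        8 * q.primeFactors.card * (N + 1) * r ≤
      ∑ a ∈ (Icc 1 q).filter (fun a => a.Coprime q),
        ∫ β in Set.Icc (-r) r, ‖primeSum N ((a : ℝ) / q + β)‖ ^ 2 := by
  set A := (Icc 1 q).filter (fun a => a.Coprime q) with hA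
  have hcont : ∀ a : ℕ, Continuous fun β : ℝ => ‖primeSum N ((a : ℝ) / q + β)‖ ^ 2 := fun a =>
    (continuous_norm.comp ((continuous_primeSum N).comp (continuous_const.add continuous_id))).pow 2
  have hcont0 : Continuous fun β : ℝ => ‖primeSum N β‖ ^ 2 :=
    (continuous_norm.comp (continuous_primeSum N)).pow 2
  rw [← integral_finsetSum _ fun a _ => (hcont a).integrableOn_Icc]
  have hvol : (volume : Measure ℝ).real (Set.Icc (-r) r) = 2 * r := by
    rw [Measure.real, Real.volume_Icc, ENNReal.toReal_ofReal (by linarith)]; ring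
  have hK : ∫ β in Set.Icc (-r) r,
      (‖primeSum N β‖ ^ 2 / q.totient - 4 * q.primeFactors.card * (N + 1)) =
      (∫ β in Set.Icc (-r) r, ‖primeSum N β‖ ^ 2) / q.totient -
        8 * q.primeFactors.card * (N + 1) * r := by
    rw [integral_sub (hcont0.integrableOn_Icc.div_const _) continuous_const.integrableOn_Icc,
      integral_div, setIntegral_const, hvol, smul_eq_mul]
    ring
  rw [← hK]
  have hsumcont : Continuous fun β : ℝ => ∑ a ∈ A, ‖primeSum N ((a : ℝ) / q + β)‖ ^ 2 :=
    continuous_finsetSum _ fun a _ => hcont a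
  exact setIntegral_mono ((hcont0.integrableOn_Icc.div_const _).sub continuous_const.integrableOn_Icc)
    hsumcont.integrableOn_Icc (fun β => sum_coprime_normSq_primeSum_translate_ge hq hsq N β)

/-! ### Geometry of the arcs: translation, periodicity, disjointness -/

/-- Translation: `∫_{[-r,r]} f(c + β) dβ = ∫_{[c-r, c+r]} f`. [folklore] -/
theorem setIntegral_Icc_comp_add {f : ℝ → ℝ} (c : ℝ) {r : ℝ} (_hr : 0 ≤ r) :
    ∫ β in Set.Icc (-r) r, f (c + β) = ∫ α in Set.Icc (c - r) (c + r), f α := by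
  rw [integral_Icc_eq_integral_Ioc, integral_Icc_eq_integral_Ioc,
    ← intervalIntegral.integral_of_le (by linarith : -r ≤ r),
    ← intervalIntegral.integral_of_le (by linarith : c - r ≤ c + r)]
  have h := intervalIntegral.integral_comp_add_right (fun x => f x) c (a := -r) (b := r)
  have hfun : (fun x => f (c + x)) = fun x => f (x + c) := funext fun x => by rw [add_comm]
  rw [hfun, h, show -r + c = c - r by ring, show r + c = c + r by ring]

/-- The two ends `[0, r]`, `[1-r, 1]` of `[0,1]` carry `∫_{[-r,r]} |S|²` (`S` has period `1`; any `r > 0`).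
[folklore] -/
theorem setIntegral_normSq_primeSum_ends (N : ℕ) {r : ℝ} (hr0 : 0 < r) :
    (∫ β in Set.Icc 0 r, ‖primeSum N β‖ ^ 2) + ∫ β in Set.Icc (1 - r) 1, ‖primeSum N β‖ ^ 2 =
      ∫ β in Set.Icc (-r) r, ‖primeSum N β‖ ^ 2 := by
  set g : ℝ → ℝ := fun β => ‖primeSum N β‖ ^ 2 with hg
  have hgc : Continuous g := (continuous_norm.comp (continuous_primeSum N)).pow 2
  have hper : ∀ x, g (x + 1) = g x := fun x => by simp only [hg, primeSum_add_one]
  rw [integral_Icc_eq_integral_Ioc, integral_Icc_eq_integral_Ioc, integral_Icc_eq_integral_Ioc,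
    ← intervalIntegral.integral_of_le hr0.le, ← intervalIntegral.integral_of_le (by linarith),
    ← intervalIntegral.integral_of_le (by linarith)]
  have h1 : ∫ x in (1 - r)..1, g x = ∫ x in (-r)..0, g x := by
    have h := intervalIntegral.integral_comp_add_right g 1 (a := -r) (b := 0)
    simp only [hper] at h
    rw [h, show -r + 1 = 1 - r by ring, show (0 : ℝ) + 1 = 1 by ring]
  change (∫ x in (0 : ℝ)..r, g x) + ∫ x in (1 - r)..1, g x = ∫ x in (-r)..r, g x
  rw [h1, add_comm,
    intervalIntegral.integral_add_adjacent_intervals (hgc.intervalIntegrable _ _)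
      (hgc.intervalIntegrable _ _)]

/-- **Distinct arcs are disjoint**: for reduced fractions `a/q ≠ a'/q'` and `q + q' < Q`, the arcs
`[a/q ± 1/(qQ)]`, `[a'/q' ± 1/(q'Q)]` do not meet (`|a/q - a'/q'| ≥ 1/(qq') > (q+q')/(qq'Q)`).
[cite: MontgomeryVaughanActa1975, §2 (2.4)] -/
theorem majorArc_disjoint {Q : ℝ} {q q' a a' : ℕ} (hq : 1 ≤ q) (hq' : 1 ≤ q') (ha : a.Coprime q)
    (ha' : a'.Coprime q') (hne : (⟨q, a⟩ : (_ : ℕ) × ℕ) ≠ ⟨q', a'⟩) (hQ : (q : ℝ) + q' < Q) :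
    Disjoint (Set.Icc ((a : ℝ) / q - 1 / (q * Q)) ((a : ℝ) / q + 1 / (q * Q)))
      (Set.Icc ((a' : ℝ) / q' - 1 / (q' * Q)) ((a' : ℝ) / q' + 1 / (q' * Q))) := by
  have hq0 : (0 : ℝ) < q := by exact_mod_cast hq
  have hq0' : (0 : ℝ) < q' := by exact_mod_cast hq'
  have hQ0 : 0 < Q := by linarith
  rw [Set.disjoint_left]
  intro z hz hz'
  rw [Set.mem_Icc] at hz hz'
  -- `a q' ≠ a' q`
  have hint : (a : ℤ) * q' - a' * q ≠ 0 := by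
    intro h0
    have heq : a * q' = a' * q := by
      have : (a : ℤ) * q' = a' * q := by linarith
      exact_mod_cast this
    have h1 : q ∣ q' := by
      have : q ∣ a * q' := ⟨a', by rw [heq]; ring⟩
      exact (Nat.Coprime.symm ha).dvd_of_dvd_mul_left this
    have h2 : q' ∣ q := by
      have : q' ∣ a' * q := ⟨a, by rw [← heq]; ring⟩
      exact (Nat.Coprime.symm ha').dvd_of_dvd_mul_left this
    have hqq : q = q' := Nat.dvd_antisymm h1 h2
    subst hqq
    have haa : a = a' := Nat.eq_of_mul_eq_mul_right (by omega) heq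
    subst haa
    exact hne rfl
  have habs : (1 : ℝ) ≤ |(a : ℝ) * q' - a' * q| := by
    have h1 : (1 : ℤ) ≤ |(a : ℤ) * q' - a' * q| := Int.one_le_abs hint
    have h2 : ((1 : ℤ) : ℝ) ≤ (|(a : ℤ) * q' - a' * q| : ℤ) := by exact_mod_cast h1
    simpa using h2
  -- `|a/q - a'/q'| ≤ 1/(qQ) + 1/(q'Q)`
  have hdiff : |(a : ℝ) / q - a' / q'| ≤ 1 / (q * Q) + 1 / (q' * Q) := by
    rw [abs_le]; constructor <;> linarith [hz.1, hz.2, hz'.1, hz'.2]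
  have hfrac : (a : ℝ) / q - a' / q' = ((a : ℝ) * q' - a' * q) / (q * q') := by
    field_simp
  rw [hfrac, abs_div, abs_of_pos (by positivity : (0 : ℝ) < q * q')] at hdiff
  rw [div_le_iff₀ (by positivity)] at hdiff
  have hsum : (1 / (q * Q) + 1 / (q' * Q)) * (q * q') = (q + q') / Q := by
    field_simp
    ring
  rw [hsum] at hdiff
  have : (q + q' : ℝ) / Q < 1 := by rw [div_lt_one hQ0]; exact hQ
  linarith

/-- **The disjoint sub-family of arcs inside `[0,1] ∩ 𝔐`**: for `M ≤ P`, `P ≥ 1`, `Q ≥ 4`,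
`2M + 2 ≤ Q`, the arcs `[a/q ± 1/(qQ)]` (`2 ≤ q ≤ M` square-free, `(a,q) = 1`) together with the two
ends `[0, 1/Q] ∪ [1 - 1/Q, 1]` of the arc at `a/q = 1` are pairwise disjoint subsets of
`[0,1] ∩ periodicArcs P Q`; hence
`∑_{q} ∑_{a} ∫_{|β| ≤ 1/(qQ)} |S(a/q+β)|² + ∫_{|β| ≤ 1/Q} |S|² ≤ R_𝔐(0) = ∫_{[0,1]∩𝔐} |S|²`.
[cite: PintzRuzsa2003, §2 (2.2)–(2.3) and §8 (8.20)] -/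
theorem sum_setIntegral_arcs_le_majorArcPairIntegral (N M : ℕ) {P Q : ℝ} (hMP : (M : ℝ) ≤ P)
    (hP1 : 1 ≤ P) (hQ4 : 4 ≤ Q) (hMQ : 2 * (M : ℝ) + 2 ≤ Q) :
    (∑ q ∈ (Icc 2 M).filter Squarefree, ∑ a ∈ (Icc 1 q).filter (fun a => a.Coprime q),
        ∫ β in Set.Icc (-(1 / (q * Q))) (1 / (q * Q)), ‖primeSum N ((a : ℝ) / q + β)‖ ^ 2) +
      ∫ β in Set.Icc (-(1 / Q)) (1 / Q), ‖primeSum N β‖ ^ 2 ≤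
      majorArcPairIntegral (periodicArcs P Q) N 0 := by
  classical
  set g : ℝ → ℝ := fun β => ‖primeSum N β‖ ^ 2 with hg
  have hgc : Continuous g := (continuous_norm.comp (continuous_primeSum N)).pow 2
  have hg0 : ∀ β, 0 ≤ g β := fun β => sq_nonneg _
  have hgint : ∀ s : Set ℝ, s ⊆ Set.Icc (0 : ℝ) 1 → IntegrableOn g s := fun s hs =>
    hgc.integrableOn_Icc.mono_set hs
  have hQ0 : 0 < Q := by linarith
  have hQ1 : 1 / Q ≤ 1 / 4 := one_div_le_one_div_of_le (by norm_num) hQ4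
  have hQpos : 0 < 1 / Q := by positivity
  -- the value `R_𝔐(0)`
  have h0 : majorArcPairIntegral (periodicArcs P Q) N 0 =
      ∫ α in Set.Icc (0 : ℝ) 1 ∩ periodicArcs P Q, g α := by
    unfold majorArcPairIntegral
    simp only [Int.cast_zero, zero_mul, AddChar.map_zero_eq_one, Circle.coe_one, mul_one]
    rw [integral_complex_ofReal, Complex.ofReal_re]
  -- the index set and the pieces
  set t : Finset ((_ : ℕ) × ℕ) :=
    ((Icc 2 M).filter Squarefree).sigma (fun q => (Icc 1 q).filter (fun a => a.Coprime q)) with ht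
  set piece : ((_ : ℕ) × ℕ) → Set ℝ := fun x =>
    Set.Icc ((x.2 : ℝ) / x.1 - 1 / (x.1 * Q)) ((x.2 : ℝ) / x.1 + 1 / (x.1 * Q)) with hpiece
  set E₀ : Set ℝ := Set.Icc 0 (1 / Q) with hE₀
  set E₁ : Set ℝ := Set.Icc (1 - 1 / Q) 1 with hE₁
  -- membership facts for `x ∈ t`
  have hmem : ∀ x ∈ t, 2 ≤ x.1 ∧ x.1 ≤ M ∧ 1 ≤ x.2 ∧ x.2 < x.1 ∧ x.2.Coprime x.1 := by
    intro x hx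
    simp only [ht, Finset.mem_sigma, mem_filter, mem_Icc] at hx
    obtain ⟨⟨⟨h2, hM⟩, -⟩, ⟨h1, hle⟩, hcop⟩ := hx
    refine ⟨h2, hM, h1, lt_of_le_of_ne hle ?_, hcop⟩
    intro heq
    rw [heq, Nat.coprime_self] at hcop
    omega
  -- each piece lies in `(1/Q, 1 - 1/Q)`, inside `[0,1] ∩ 𝔐`
  have hbounds : ∀ x ∈ t, 1 / Q < (x.2 : ℝ) / x.1 - 1 / (x.1 * Q) ∧
      (x.2 : ℝ) / x.1 + 1 / (x.1 * Q) < 1 - 1 / Q := by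
    intro x hx
    obtain ⟨h2, hM, h1, hlt, -⟩ := hmem x hx
    have hq0 : (0 : ℝ) < x.1 := by exact_mod_cast (show 0 < x.1 by omega)
    have ha1 : (1 : ℝ) ≤ x.2 := by exact_mod_cast h1
    have haq : (x.2 : ℝ) ≤ x.1 - 1 := by
      have : x.2 + 1 ≤ x.1 := hlt
      have : ((x.2 : ℕ) : ℝ) + 1 ≤ x.1 := by exact_mod_cast this
      linarith
    have hqM : (x.1 : ℝ) ≤ M := by exact_mod_cast hM
    have hqQ : (x.1 : ℝ) + 1 < Q := by linarith
    have hD : 0 < (Q - 1 - x.1) / (x.1 * Q) := div_pos (by linarith) (by positivity)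
    have hlow : (1 : ℝ) / x.1 ≤ (x.2 : ℝ) / x.1 := div_le_div_of_nonneg_right ha1 hq0.le
    have hup : (x.2 : ℝ) / x.1 ≤ 1 - 1 / x.1 := by
      have h := div_le_div_of_nonneg_right haq hq0.le
      rwa [sub_div, div_self hq0.ne'] at h
    have hid1 : 1 / (x.1 : ℝ) - 1 / (x.1 * Q) - 1 / Q = (Q - 1 - x.1) / (x.1 * Q) := by
      field_simp
    have hid2 : (1 - 1 / Q) - ((1 - 1 / (x.1 : ℝ)) + 1 / (x.1 * Q)) = (Q - 1 - x.1) / (x.1 * Q) := by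
      field_simp
      ring
    constructor
    · linarith
    · linarith
  have hsub_piece : ∀ x ∈ t, piece x ⊆ Set.Icc (0 : ℝ) 1 ∩ periodicArcs P Q := by
    intro x hx z hz
    obtain ⟨h2, hM, h1, hlt, hcop⟩ := hmem x hx
    have hb := hbounds x hx
    simp only [hpiece, Set.mem_Icc] at hz
    refine ⟨⟨by linarith [hQpos.le], by linarith [hQpos.le]⟩, ?_⟩
    rw [mem_periodicArcs]
    left
    simp only [MontgomeryVaughan1975.majorArcs, Set.mem_iUnion, exists_prop]
    refine ⟨x.1, ?_, x.2, ?_, ?_⟩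
    · rw [Finset.mem_Icc]
      exact ⟨by omega, Nat.le_floor ((show (x.1 : ℝ) ≤ M by exact_mod_cast hM).trans hMP)⟩
    · rw [mem_filter, Finset.mem_Icc]
      exact ⟨⟨h1, hlt.le⟩, hcop⟩
    · simp only [MontgomeryVaughan1975.majorArc, Set.mem_Icc]
      exact hz
  have hone : (1 : ℕ) ∈ Finset.Icc 1 ⌊P⌋₊ := by
    rw [Finset.mem_Icc]; exact ⟨le_rfl, Nat.le_floor (by simpa using hP1)⟩
  have hone' : (1 : ℕ) ∈ (Finset.Icc 1 1).filter (fun a => a.Coprime 1) := by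
    rw [mem_filter, Finset.mem_Icc]; exact ⟨⟨le_rfl, le_rfl⟩, Nat.coprime_one_right 1⟩
  have hsub_E₁ : E₁ ⊆ Set.Icc (0 : ℝ) 1 ∩ periodicArcs P Q := by
    intro z hz
    simp only [hE₁, Set.mem_Icc] at hz
    refine ⟨⟨by linarith, hz.2⟩, ?_⟩
    rw [mem_periodicArcs]
    left
    simp only [MontgomeryVaughan1975.majorArcs, Set.mem_iUnion, exists_prop]
    refine ⟨1, hone, 1, hone', ?_⟩
    simp only [MontgomeryVaughan1975.majorArc, Set.mem_Icc, Nat.cast_one, div_one, one_mul]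
    constructor <;> linarith
  have hsub_E₀ : E₀ ⊆ Set.Icc (0 : ℝ) 1 ∩ periodicArcs P Q := by
    intro z hz
    simp only [hE₀, Set.mem_Icc] at hz
    refine ⟨⟨hz.1, by linarith⟩, ?_⟩
    rw [mem_periodicArcs]
    right
    simp only [MontgomeryVaughan1975.majorArcs, Set.mem_iUnion, exists_prop]
    refine ⟨1, hone, 1, hone', ?_⟩
    simp only [MontgomeryVaughan1975.majorArc, Set.mem_Icc, Nat.cast_one, div_one, one_mul]
    constructor <;> linarith
  -- disjointness
  have hdisj_t : Set.Pairwise (↑t : Set ((_ : ℕ) × ℕ)) (Function.onFun Disjoint piece) := by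
    intro x hx y hy hxy
    obtain ⟨hx2, hxM, -, -, hxc⟩ := hmem x hx
    obtain ⟨hy2, hyM, -, -, hyc⟩ := hmem y hy
    have hxy' : (⟨x.1, x.2⟩ : (_ : ℕ) × ℕ) ≠ ⟨y.1, y.2⟩ := by
      intro h; exact hxy (Sigma.ext (congrArg Sigma.fst h) (heq_of_eq (by
        have := congrArg Sigma.snd h; simpa using this)))
    have hQ' : (x.1 : ℝ) + y.1 < Q := by
      have : (x.1 : ℝ) ≤ M := by exact_mod_cast hxM
      have : (y.1 : ℝ) ≤ M := by exact_mod_cast hyM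
      linarith
    exact majorArc_disjoint (by omega) (by omega) hxc hyc hxy' hQ'
  have hdisj_E : Disjoint E₀ E₁ := by
    rw [Set.disjoint_left]
    intro z hz hz'
    simp only [hE₀, hE₁, Set.mem_Icc] at hz hz'
    have : 1 / Q < 1 - 1 / Q := by linarith
    linarith
  have hdisj_U : Disjoint (⋃ x ∈ t, piece x) (E₀ ∪ E₁) := by
    rw [Set.disjoint_left]
    intro z hz hz'
    simp only [Set.mem_iUnion, exists_prop] at hz
    obtain ⟨x, hx, hzx⟩ := hz
    have hb := hbounds x hx
    simp only [hpiece, Set.mem_Icc] at hzx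
    rcases hz' with h | h
    · simp only [hE₀, Set.mem_Icc] at h; linarith
    · simp only [hE₁, Set.mem_Icc] at h; linarith
  -- measurability / integrability
  have hmeas_piece : ∀ x ∈ t, MeasurableSet (piece x) := fun x _ => measurableSet_Icc
  have hU_sub : (⋃ x ∈ t, piece x) ∪ (E₀ ∪ E₁) ⊆ Set.Icc (0 : ℝ) 1 ∩ periodicArcs P Q :=
    Set.union_subset (Set.iUnion₂_subset hsub_piece) (Set.union_subset hsub_E₀ hsub_E₁)
  have hU_sub' : (⋃ x ∈ t, piece x) ∪ (E₀ ∪ E₁) ⊆ Set.Icc (0 : ℝ) 1 :=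
    hU_sub.trans Set.inter_subset_left
  -- the chain of (in)equalities
  have hsplit : ∫ α in (⋃ x ∈ t, piece x) ∪ (E₀ ∪ E₁), g α =
      (∑ x ∈ t, ∫ α in piece x, g α) + ((∫ α in E₀, g α) + ∫ α in E₁, g α) := by
    rw [setIntegral_union hdisj_U (measurableSet_Icc.union measurableSet_Icc)
        (hgint _ (Set.subset_union_left.trans hU_sub'))
        (hgint _ (Set.subset_union_right.trans hU_sub')),
      integral_biUnion_finset t hmeas_piece hdisj_t
        (fun x hx => hgint _ ((Set.subset_iUnion₂ (s := fun x _ => piece x) x hx).trans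
          (Set.subset_union_left.trans hU_sub'))),
      setIntegral_union hdisj_E measurableSet_Icc
        (hgint _ (hsub_E₀.trans Set.inter_subset_left))
        (hgint _ (hsub_E₁.trans Set.inter_subset_left))]
  -- identify the pieces
  have hpieces : ∑ x ∈ t, ∫ α in piece x, g α =
      ∑ q ∈ (Icc 2 M).filter Squarefree, ∑ a ∈ (Icc 1 q).filter (fun a => a.Coprime q),
        ∫ β in Set.Icc (-(1 / (q * Q))) (1 / (q * Q)), g ((a : ℝ) / q + β) := by
    rw [ht, Finset.sum_sigma]
    refine Finset.sum_congr rfl fun q hq => Finset.sum_congr rfl fun a _ => ?_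
    rw [mem_filter, mem_Icc] at hq
    have hr : (0 : ℝ) ≤ 1 / (q * Q) := by
      have : (0 : ℝ) < q := by exact_mod_cast (show 0 < q by omega)
      positivity
    rw [setIntegral_Icc_comp_add ((a : ℝ) / q) hr]
  have hends : (∫ α in E₀, g α) + ∫ α in E₁, g α = ∫ β in Set.Icc (-(1 / Q)) (1 / Q), g β :=
    setIntegral_normSq_primeSum_ends N hQpos
  rw [h0]
  calc (∑ q ∈ (Icc 2 M).filter Squarefree, ∑ a ∈ (Icc 1 q).filter (fun a => a.Coprime q),
          ∫ β in Set.Icc (-(1 / (q * Q))) (1 / (q * Q)), g ((a : ℝ) / q + β)) +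
        ∫ β in Set.Icc (-(1 / Q)) (1 / Q), g β
      = ∫ α in (⋃ x ∈ t, piece x) ∪ (E₀ ∪ E₁), g α := by rw [hsplit, hpieces, hends]
    _ ≤ ∫ α in Set.Icc (0 : ℝ) 1 ∩ periodicArcs P Q, g α :=
        setIntegral_mono_set (hgint _ Set.inter_subset_left) (Eventually.of_forall hg0)
          (Eventually.of_forall hU_sub)

/-! ### Arithmetic: `ω(q) ≤ 2 log q`, `∑ 1/q ≤ 1 + log M`, `∑_{q ≤ M} μ²(q)/φ(q) ≥ log M` -/

/-- `ω(q) ≤ 2 log q` (`2^{ω(q)} ≤ ∏_{p ∣ q} p ≤ q` and `1/log 2 < 2`). [folklore] -/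
theorem card_primeFactors_le_two_mul_log {q : ℕ} (hq : q ≠ 0) :
    (q.primeFactors.card : ℝ) ≤ 2 * Real.log q := by
  have h2pow : 2 ^ q.primeFactors.card ≤ q := by
    calc 2 ^ q.primeFactors.card ≤ ∏ p ∈ q.primeFactors, p :=
          Finset.pow_card_le_prod _ _ _ fun p hp => (Nat.prime_of_mem_primeFactors hp).two_le
      _ ≤ q := Nat.le_of_dvd (Nat.pos_of_ne_zero hq) (Nat.prod_primeFactors_dvd q)
  have h : (q.primeFactors.card : ℝ) * Real.log 2 ≤ Real.log q := by
    have h1 : ((2 : ℝ) ^ q.primeFactors.card) ≤ q := by exact_mod_cast h2pow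
    have h2 := Real.log_le_log (by positivity) h1
    rwa [Real.log_pow] at h2
  have hl2 : (1 / 2 : ℝ) < Real.log 2 := by have := Real.log_two_gt_d9; linarith
  nlinarith [Nat.cast_nonneg (α := ℝ) q.primeFactors.card]

/-- `∑_{q ≤ M} 1/q ≤ 1 + log M`. [folklore] -/
theorem sum_Icc_inv_le_one_add_log (M : ℕ) :
    ∑ q ∈ Icc 1 M, (1 : ℝ) / q ≤ 1 + Real.log M := by
  have h := harmonic_le_one_add_log M
  rw [harmonic_eq_sum_Icc] at h
  push_cast at h
  simpa only [one_div] using h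

/-- `log M ≤ ∑_{q ≤ M, q square-free} 1/φ(q)` (the tree's `LargeSieve.log_le_mul_sum_inv_totient`
at `q = 1`: `∑ μ²(d)/φ(d) ≥ ∑_{n ≤ M} 1/n ≥ log M`). [cite: MontgomeryVaughan2007, §3 (Selberg's sum)] -/
theorem log_le_sum_squarefree_inv_totient (M : ℕ) :
    Real.log M ≤ ∑ q ∈ (Icc 1 M).filter Squarefree, ((q.totient : ℕ) : ℝ)⁻¹ := by
  have h := LargeSieve.log_le_mul_sum_inv_totient (q := 1) one_ne_zero (y := (M : ℝ))
    (Nat.cast_nonneg M)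
  simp only [Nat.floor_natCast, Nat.totient_one, Nat.cast_one, div_one, one_mul] at h
  refine h.trans (le_of_eq (Finset.sum_congr ?_ fun _ _ => rfl))
  ext d
  simp only [mem_filter, Nat.coprime_one_right_eq_true, and_true]

/-- The error terms: `∑_{2 ≤ q ≤ M, sqfree} 8 ω(q) (N+1)/(qQ) ≤ 16 (N+1) log M (1 + log M)/Q` (`Q > 0`).
[folklore] -/
theorem sum_err_le (N M : ℕ) {Q : ℝ} (hQ : 0 < Q) :
    ∑ q ∈ (Icc 2 M).filter Squarefree,
        8 * (q.primeFactors.card : ℝ) * (N + 1) * (1 / (q * Q)) ≤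
      16 * (N + 1) * Real.log M * (1 + Real.log M) / Q := by
  have hterm : ∀ q ∈ (Icc 2 M).filter Squarefree,
      8 * (q.primeFactors.card : ℝ) * (N + 1) * (1 / (q * Q)) ≤
        (16 * (N + 1) * Real.log M / Q) * (1 / q) := by
    intro q hq
    rw [mem_filter, mem_Icc] at hq
    have hq0 : (0 : ℝ) < q := by exact_mod_cast (show 0 < q by omega)
    have hqM : (q : ℝ) ≤ M := by exact_mod_cast hq.1.2
    have hω := card_primeFactors_le_two_mul_log (q := q) (by omega)
    have hlogq : Real.log q ≤ Real.log M := Real.log_le_log hq0 hqM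
    have hlog0 : 0 ≤ Real.log q := Real.log_natCast_nonneg q
    calc 8 * (q.primeFactors.card : ℝ) * (N + 1) * (1 / (q * Q))
        = (8 * (N + 1) / Q) * (q.primeFactors.card : ℝ) * (1 / q) := by field_simp
      _ ≤ (8 * (N + 1) / Q) * (2 * Real.log M) * (1 / q) := by
          refine mul_le_mul_of_nonneg_right (mul_le_mul_of_nonneg_left (hω.trans (by linarith))
            (by positivity)) (by positivity)
      _ = (16 * (N + 1) * Real.log M / Q) * (1 / q) := by ring
  refine (Finset.sum_le_sum hterm).trans ?_
  rw [← Finset.mul_sum]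
  have hsub : ∑ q ∈ (Icc 2 M).filter Squarefree, (1 : ℝ) / q ≤ 1 + Real.log M := by
    refine le_trans (Finset.sum_le_sum_of_subset_of_nonneg ?_ fun q _ _ => by positivity)
      (sum_Icc_inv_le_one_add_log M)
    intro q hq
    rw [mem_filter, mem_Icc] at hq
    rw [mem_Icc]; omega
  have hM0 : 0 ≤ Real.log M := Real.log_natCast_nonneg M
  calc 16 * (N + 1) * Real.log M / Q * ∑ q ∈ (Icc 2 M).filter Squarefree, (1 : ℝ) / q
      ≤ 16 * (N + 1) * Real.log M / Q * (1 + Real.log M) :=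
        mul_le_mul_of_nonneg_left hsub (by positivity)
    _ = 16 * (N + 1) * Real.log M * (1 + Real.log M) / Q := by ring

/-! ### The mass of `|S|²` on the major arcs -/

/-- **Lower bound for `R_𝔐(0) = ∫_{[0,1]∩𝔐} |S|²` at fixed `N`**: with `M ≤ P`, `P ≥ 1`, `Q ≥ 4`,
`2M + 2 ≤ Q`, `r₀ ≤ 1/Q` and `M Q r₀ ≤ 1` (so that every arc radius `1/(qQ)`, `q ≤ M`, is `≥ r₀`),
`R_𝔐(0) ≥ (∫_{|β| ≤ r₀} |S|²) · ∑_{q ≤ M, q sqfree} 1/φ(q) - ∑_{2 ≤ q ≤ M, sqfree} 8 ω(q)(N+1)/(qQ)`.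
[cite: PintzRuzsa2003, §8 (8.20) (lower bound, by positivity)] -/
theorem majorArcPairIntegral_zero_ge (N M : ℕ) {P Q r₀ : ℝ} (hMP : (M : ℝ) ≤ P) (hP1 : 1 ≤ P)
    (hQ4 : 4 ≤ Q) (hMQ : 2 * (M : ℝ) + 2 ≤ Q) (hr₀Q : r₀ ≤ 1 / Q)
    (hMr : (M : ℝ) * Q * r₀ ≤ 1) :
    (∫ β in Set.Icc (-r₀) r₀, ‖primeSum N β‖ ^ 2) *
          ∑ q ∈ (Icc 1 M).filter Squarefree, ((q.totient : ℕ) : ℝ)⁻¹ -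
        ∑ q ∈ (Icc 2 M).filter Squarefree,
          8 * (q.primeFactors.card : ℝ) * (N + 1) * (1 / (q * Q)) ≤
      majorArcPairIntegral (periodicArcs P Q) N 0 := by
  have hQ0 : 0 < Q := by linarith
  have hgeo := sum_setIntegral_arcs_le_majorArcPairIntegral N M hMP hP1 hQ4 hMQ
  set I : ℝ → ℝ := fun r => ∫ β in Set.Icc (-r) r, ‖primeSum N β‖ ^ 2 with hI
  have hcont0 : Continuous fun β : ℝ => ‖primeSum N β‖ ^ 2 :=
    (continuous_norm.comp (continuous_primeSum N)).pow 2
  have hImono : ∀ r, r₀ ≤ r → I r₀ ≤ I r := by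
    intro r hr
    exact setIntegral_mono_set hcont0.integrableOn_Icc (Eventually.of_forall fun _ => sq_nonneg _)
      (Eventually.of_forall (Set.Icc_subset_Icc (by linarith) hr))
  have hI0 : 0 ≤ I r₀ := integral_nonneg fun _ => sq_nonneg _
  -- per `q`
  have hq : ∀ q ∈ (Icc 2 M).filter Squarefree,
      I r₀ * ((q.totient : ℕ) : ℝ)⁻¹ - 8 * (q.primeFactors.card : ℝ) * (N + 1) * (1 / (q * Q)) ≤
        ∑ a ∈ (Icc 1 q).filter (fun a => a.Coprime q),
          ∫ β in Set.Icc (-(1 / (q * Q))) (1 / (q * Q)), ‖primeSum N ((a : ℝ) / q + β)‖ ^ 2 := by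
    intro q hq
    rw [mem_filter, mem_Icc] at hq
    have hq0 : (0 : ℝ) < q := by exact_mod_cast (show 0 < q by omega)
    have hr : 0 < 1 / (q * Q) := by positivity
    have hcore := sum_coprime_setIntegral_normSq_translate_ge hq.1.1 hq.2 N hr
    refine le_trans ?_ hcore
    have hrr : r₀ ≤ 1 / (q * Q) := by
      rw [le_div_iff₀ (by positivity)]
      have hqM : (q : ℝ) ≤ M := by exact_mod_cast hq.1.2
      nlinarith
    have h1 : I r₀ * ((q.totient : ℕ) : ℝ)⁻¹ ≤ I (1 / (q * Q)) / q.totient := by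
      rw [div_eq_mul_inv]
      exact mul_le_mul_of_nonneg_right (hImono _ hrr) (by positivity)
    have h2 : 8 * (q.primeFactors.card : ℝ) * (N + 1) * (1 / (q * Q)) =
        8 * q.primeFactors.card * (N + 1) * (1 / (q * Q)) := rfl
    simp only [hI] at h1 ⊢
    linarith
  have hsumq := Finset.sum_le_sum hq
  rw [Finset.sum_sub_distrib, ← Finset.mul_sum] at hsumq
  -- the `q = 1` term
  have h1 : I r₀ ≤ I (1 / Q) := hImono _ hr₀Q
  -- `∑_{Icc 1 M} ≤ 1 + ∑_{Icc 2 M}`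
  have hsplit : ∑ q ∈ (Icc 1 M).filter Squarefree, ((q.totient : ℕ) : ℝ)⁻¹ ≤
      1 + ∑ q ∈ (Icc 2 M).filter Squarefree, ((q.totient : ℕ) : ℝ)⁻¹ := by
    have hsub : (Icc 1 M).filter Squarefree ⊆ insert 1 ((Icc 2 M).filter Squarefree) := by
      intro q hq
      rw [mem_filter, mem_Icc] at hq
      rw [Finset.mem_insert, mem_filter, mem_Icc]
      by_cases h1 : q = 1
      · exact Or.inl h1
      · exact Or.inr ⟨⟨by omega, hq.1.2⟩, hq.2⟩
    have h1 : (1 : ℕ) ∉ (Icc 2 M).filter Squarefree := by simp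
    calc ∑ q ∈ (Icc 1 M).filter Squarefree, ((q.totient : ℕ) : ℝ)⁻¹
        ≤ ∑ q ∈ insert 1 ((Icc 2 M).filter Squarefree), ((q.totient : ℕ) : ℝ)⁻¹ :=
          Finset.sum_le_sum_of_subset_of_nonneg hsub fun _ _ _ => by positivity
      _ = 1 + ∑ q ∈ (Icc 2 M).filter Squarefree, ((q.totient : ℕ) : ℝ)⁻¹ := by
          rw [Finset.sum_insert h1]; simp
  have hmain : I r₀ * ∑ q ∈ (Icc 1 M).filter Squarefree, ((q.totient : ℕ) : ℝ)⁻¹ ≤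
      I r₀ * ∑ q ∈ (Icc 2 M).filter Squarefree, ((q.totient : ℕ) : ℝ)⁻¹ + I (1 / Q) := by
    calc I r₀ * ∑ q ∈ (Icc 1 M).filter Squarefree, ((q.totient : ℕ) : ℝ)⁻¹
        ≤ I r₀ * (1 + ∑ q ∈ (Icc 2 M).filter Squarefree, ((q.totient : ℕ) : ℝ)⁻¹) :=
          mul_le_mul_of_nonneg_left hsplit hI0
      _ = I r₀ * ∑ q ∈ (Icc 2 M).filter Squarefree, ((q.totient : ℕ) : ℝ)⁻¹ + I r₀ := by ring
      _ ≤ _ := add_le_add le_rfl h1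
  simp only [hI] at hmain hsumq hgeo h1 ⊢
  linarith

/-- Eventually `c · log³ N ≤ N^θ` (`θ > 0`), for any `c`. [folklore] -/
theorem eventually_mul_log_pow_three_le_rpow {θ : ℝ} (hθ : 0 < θ) (c : ℝ) :
    ∀ᶠ N : ℕ in atTop, c * Real.log N ^ 3 ≤ (N : ℝ) ^ θ := by
  rcases le_or_gt c 0 with hc | hc
  · filter_upwards [eventually_ge_atTop 1] with N hN
    have hN1 : (1 : ℝ) ≤ N := by exact_mod_cast hN
    have : c * Real.log N ^ 3 ≤ 0 :=
      mul_nonpos_of_nonpos_of_nonneg hc (pow_nonneg (Real.log_nonneg hN1) 3)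
    exact this.trans (Real.rpow_nonneg (by linarith) _)
  have h := (isLittleO_log_rpow_rpow_atTop (3 : ℝ) hθ).bound (by positivity : (0 : ℝ) < 1 / c)
  filter_upwards [tendsto_natCast_atTop_atTop.eventually h, eventually_ge_atTop 1] with N hN hN1
  have hN1' : (1 : ℝ) ≤ N := by exact_mod_cast hN1
  have hlog : 0 ≤ Real.log N := Real.log_nonneg hN1'
  rw [Real.norm_of_nonneg (Real.rpow_nonneg hlog _),
    Real.norm_of_nonneg (Real.rpow_nonneg (by linarith) _),
    show (3 : ℝ) = ((3 : ℕ) : ℝ) by norm_num, Real.rpow_natCast] at hN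
  calc c * Real.log N ^ 3 = Real.log N ^ 3 / (1 / c) := by field_simp
    _ ≤ (N : ℝ) ^ θ := by rw [div_le_iff₀ (by positivity)]; linarith [hN]

set_option maxHeartbeats 1000000 in
/-- **Pintz–Ruzsa I (8.20)–(8.21), unconditionally**: for Pintz–Ruzsa's arcs (2.2)–(2.3) at levels
`N^θ ≤ P(N)`, `N^θ ≤ Q(N) ≤ N^{1-θ}` (`0 < θ ≤ 1`), for every `ε > 0` and all large `N`,
`π₂(N) - ∫_{[0,1]∩𝔐_N} |S|² ≤ (1 - θ + ε) N/log N`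
(indeed `∫_𝔐 |S|² ≥ (θ - ε) N/log N`: the disjoint arcs `q ≤ N^θ/(16 log³ N)` square-free carry
`≥ (1/φ(q) - o(1)) N/log² N` each by positivity and the central-arc estimate, and
`∑_{q ≤ x} μ²(q)/φ(q) ≥ log x`). This is the hypothesis `hM0` of
`GoldbachLinnik.minor_meanSquare_le_four` / `goldbach_linnik_of_majorArcs_largeDeviations`.
[cite: PintzRuzsa2003, §8 (8.20)–(8.21)] -/
theorem eventually_card_oddPrimes_sub_majorArcPairIntegral_le {P Q : ℕ → ℝ} {θ : ℝ}
    (hθ0 : 0 < θ) (hθ1 : θ ≤ 1)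
    (hP : ∀ᶠ N : ℕ in atTop, (N : ℝ) ^ θ ≤ P N)
    (hQ1 : ∀ᶠ N : ℕ in atTop, (N : ℝ) ^ θ ≤ Q N)
    (hQ2 : ∀ᶠ N : ℕ in atTop, Q N ≤ (N : ℝ) ^ (1 - θ)) :
    ∀ ε : ℝ, 0 < ε → ∀ᶠ N : ℕ in atTop,
      ((oddPrimes N).card : ℝ) - majorArcPairIntegral (periodicArcs (P N) (Q N)) N 0 ≤
        (1 - θ + ε) * N / Real.log N := by
  -- it suffices to treat `ε ≤ 1/2`
  suffices H : ∀ ε : ℝ, 0 < ε → ε ≤ 1 / 2 → ∀ᶠ N : ℕ in atTop,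
      ((oddPrimes N).card : ℝ) - majorArcPairIntegral (periodicArcs (P N) (Q N)) N 0 ≤
        (1 - θ + ε) * N / Real.log N by
    intro ε hε
    filter_upwards [H (min ε (1 / 2)) (by positivity) (min_le_right _ _), eventually_ge_atTop 2]
      with N hN hN2
    refine hN.trans ?_
    have hlog : 0 < Real.log N := Real.log_pos (by exact_mod_cast (show 1 < N by omega))
    have hN0 : (0 : ℝ) ≤ N := Nat.cast_nonneg N
    have : (1 - θ + min ε (1 / 2)) * N ≤ (1 - θ + ε) * N :=
      mul_le_mul_of_nonneg_right (by linarith [min_le_left ε (1 / 2)]) hN0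
    exact div_le_div_of_nonneg_right this hlog.le
  intro ε hε hε2
  set ε₁ : ℝ := ε / 8 with hε₁
  have hε₁0 : 0 < ε₁ := by positivity
  -- inputs
  have hcentral := setIntegral_normSq_primeSum_central_ge ε₁ hε₁0
  have hπ : ∀ᶠ N : ℕ in atTop, ((oddPrimes N).card : ℝ) ≤ (1 + ε₁) * N / Real.log N := by
    have h := Metric.tendsto_nhds.1 tendsto_primeCounting_div ε₁ hε₁0
    filter_upwards [h, eventually_ge_atTop 2] with N hN hN2
    have hlog : 0 < Real.log N := log_pos_of_two_le hN2
    have hNpos : (0 : ℝ) < N := by exact_mod_cast lt_of_lt_of_le two_pos hN2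
    have hq : 0 < (N : ℝ) / Real.log N := div_pos hNpos hlog
    rw [Real.dist_eq, abs_lt] at hN
    have h2 := hN.2
    rw [sub_lt_iff_lt_add, div_lt_iff₀ hq] at h2
    calc ((oddPrimes N).card : ℝ) ≤ Nat.primeCounting N := by exact_mod_cast card_oddPrimes_le N
      _ ≤ (1 + ε₁) * N / Real.log N := by rw [mul_div_assoc]; linarith
  have hlogN : Tendsto (fun N : ℕ => Real.log (N : ℝ)) atTop atTop :=
    Real.tendsto_log_atTop.comp tendsto_natCast_atTop_atTop
  have hloglog : ∀ᶠ N : ℕ in atTop, Real.log 16 + 3 * Real.log (Real.log N) ≤ ε₁ * Real.log N := by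
    have h1 : ∀ᶠ N : ℕ in atTop, Real.log (Real.log N) ≤ (ε₁ / 6) * Real.log N := by
      have h := (Real.isLittleO_log_id_atTop.comp_tendsto hlogN).bound (by positivity : (0 : ℝ) < ε₁ / 6)
      filter_upwards [h, hlogN.eventually_ge_atTop 1] with N hN hlog1
      simp only [Function.comp, id] at hN
      rw [Real.norm_of_nonneg (by linarith : (0 : ℝ) ≤ Real.log N)] at hN
      exact (le_abs_self _).trans ((Real.norm_eq_abs _).symm.le.trans hN)
    have h2 : ∀ᶠ N : ℕ in atTop, Real.log 16 ≤ (ε₁ / 2) * Real.log N :=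
      (hlogN.const_mul_atTop (by positivity : (0 : ℝ) < ε₁ / 2)).eventually_ge_atTop _
    filter_upwards [h1, h2] with N h1 h2
    linarith
  have hpow1 := eventually_mul_log_pow_three_le_rpow hθ0 16
  have hpow2 := eventually_mul_log_pow_three_le_rpow hθ0 (64 / ε₁)
  filter_upwards [hP, hQ1, hQ2, hcentral, hπ, hloglog, hpow1, hpow2, eventually_ge_atTop 16]
    with N hPN hQ1N hQ2N hcN hπN hllN hp1 hp2 hN16
  -- basic quantities
  have hN0 : (0 : ℝ) < N := by exact_mod_cast (show 0 < N by omega)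
  have hN16' : (16 : ℝ) ≤ N := by exact_mod_cast hN16
  have hlog1 : 1 ≤ Real.log N := by
    have he : Real.exp 1 ≤ N := by have := Real.exp_one_lt_d9; linarith
    have := Real.log_le_log (Real.exp_pos 1) he
    rwa [Real.log_exp] at this
  have hlog0 : 0 < Real.log N := by linarith
  set L3 : ℝ := Real.log N ^ 3 with hL3
  have hL31 : 1 ≤ L3 := one_le_pow₀ hlog1
  set X : ℝ := (N : ℝ) ^ θ with hX
  have hX16 : 16 * L3 ≤ X := hp1
  have hX64 : 64 / ε₁ * L3 ≤ X := hp2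
  have hX1 : 16 ≤ X := le_trans (by linarith) hX16
  have hXN : X ≤ N := by
    simp only [hX]
    conv_rhs => rw [← Real.rpow_one (N : ℝ)]
    exact Real.rpow_le_rpow_of_exponent_le (by linarith) hθ1
  have hXmul : X * (N : ℝ) ^ (1 - θ) = N := by
    simp only [hX]; rw [← Real.rpow_add hN0]; norm_num
  set Pn := P N with hPn
  set Qn := Q N with hQn
  have hQ4 : 4 ≤ Qn := by linarith
  have hQ0 : 0 < Qn := by linarith
  have hQX : Qn * X ≤ N := by
    calc Qn * X ≤ (N : ℝ) ^ (1 - θ) * X := mul_le_mul_of_nonneg_right hQ2N (by linarith)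
      _ = N := by rw [mul_comm, hXmul]
  have hQup : Qn * L3 ≤ N / 16 := by
    have h2 : Qn * (16 * L3) ≤ Qn * X := mul_le_mul_of_nonneg_left hX16 hQ0.le
    rw [le_div_iff₀ (by norm_num)]
    linarith
  -- the parameters `r₀`, `P₂`, `M`
  set r₀ : ℝ := L3 / N with hr₀
  set P₂ : ℝ := min (min (N / (Qn * L3)) (Qn / 4 - 1)) Pn with hP₂
  set M : ℕ := ⌊P₂⌋₊ with hM
  have hP₂low : X / (8 * L3) ≤ P₂ := by
    simp only [hP₂, le_min_iff]
    refine ⟨⟨?_, ?_⟩, ?_⟩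
    · -- `N/(Q L3) ≥ X/L3 ≥ X/(8 L3)`
      rw [div_le_div_iff₀ (by positivity) (by positivity)]
      have h1 : X * (Qn * L3) ≤ N * L3 := by
        have := mul_le_mul_of_nonneg_right hQX (by positivity : (0 : ℝ) ≤ L3)
        linarith
      have h2 : (N : ℝ) * L3 ≤ N * (8 * L3) := by
        have : (0 : ℝ) ≤ N * L3 := by positivity
        linarith
      linarith
    · -- `Q/4 - 1 ≥ X/4 - 1 ≥ X/8 ≥ X/(8 L3)`
      have h1 : X / (8 * L3) ≤ X / 8 :=
        div_le_div_of_nonneg_left (by linarith) (by norm_num) (by linarith)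
      linarith
    · -- `P ≥ X ≥ X/(8 L3)`
      have h1 : X / (8 * L3) ≤ X := div_le_self (by linarith) (by linarith)
      linarith
  have hP₂pos : 0 < P₂ := lt_of_lt_of_le (by positivity) hP₂low
  have hMle : (M : ℝ) ≤ P₂ := Nat.floor_le hP₂pos.le
  have hMge : P₂ - 1 ≤ M := by
    have := Nat.lt_floor_add_one P₂
    simp only [hM]; linarith
  have hMP : (M : ℝ) ≤ Pn := hMle.trans (min_le_right _ _)
  have hP1 : 1 ≤ Pn := by linarith [le_trans hX1 (show X ≤ Pn from hPN)]
  have hMQ : 2 * (M : ℝ) + 2 ≤ Qn := by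
    have : (M : ℝ) ≤ Qn / 4 - 1 := hMle.trans ((min_le_left _ _).trans (min_le_right _ _))
    linarith
  have hr₀Q : r₀ ≤ 1 / Qn := by
    simp only [hr₀]
    rw [div_le_div_iff₀ hN0 hQ0, one_mul]
    have : (N : ℝ) / 16 ≤ N := by linarith
    linarith
  have hMr : (M : ℝ) * Qn * r₀ ≤ 1 := by
    have : (M : ℝ) ≤ N / (Qn * L3) := hMle.trans ((min_le_left _ _).trans (min_le_left _ _))
    simp only [hr₀]
    rw [le_div_iff₀ (by positivity)] at this
    rw [mul_div_assoc', div_le_one hN0]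
    linarith
  -- the fixed-`N` lower bound
  have hcore := majorArcPairIntegral_zero_ge N M hMP hP1 hQ4 hMQ hr₀Q hMr
  -- `∑ μ²/φ ≥ log M ≥ (θ - ε₁) log N`
  have hμφ := log_le_sum_squarefree_inv_totient M
  have hM16 : X / (16 * L3) ≤ M := by
    have : X / (8 * L3) - 1 ≤ M := by linarith
    have h2 : X / (16 * L3) ≤ X / (8 * L3) - 1 := by
      rw [div_le_iff₀ (by positivity)]
      have : (X / (8 * L3) - 1) * (16 * L3) = 2 * X - 16 * L3 := by field_simp; ring
      rw [this]; linarith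
    linarith
  have hM0 : (0 : ℝ) < M := lt_of_lt_of_le (by positivity) hM16
  have hlogM : (θ - ε₁) * Real.log N ≤ Real.log M := by
    have h1 : Real.log (X / (16 * L3)) ≤ Real.log M := Real.log_le_log (by positivity) hM16
    have h2 : Real.log (X / (16 * L3)) = θ * Real.log N - (Real.log 16 + 3 * Real.log (Real.log N)) := by
      rw [Real.log_div (by positivity) (by positivity), Real.log_mul (by norm_num) (by positivity),
        hX, Real.log_rpow hN0, hL3, Real.log_pow]
      push_cast
      ring
    rw [h2] at h1
    linarith
  -- the errors
  have herr := sum_err_le N M hQ0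
  have hlogMle : Real.log M ≤ Real.log N := by
    refine Real.log_le_log hM0 (hMle.trans ?_)
    calc P₂ ≤ N / (Qn * L3) := (min_le_left _ _).trans (min_le_left _ _)
      _ ≤ N := by
          rw [div_le_iff₀ (by positivity)]
          have : (1 : ℝ) ≤ Qn * L3 := by nlinarith
          exact le_mul_of_one_le_right hN0.le this
  have herr2 : 16 * ((N : ℝ) + 1) * Real.log M * (1 + Real.log M) / Qn ≤ ε₁ * N / Real.log N := by
    have hlM0 : 0 ≤ Real.log M := Real.log_nonneg (by
      have : (1 : ℝ) ≤ M := by exact_mod_cast Nat.one_le_iff_ne_zero.2 (by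
        intro h; rw [h] at hM0; simp at hM0)
      exact this)
    calc 16 * ((N : ℝ) + 1) * Real.log M * (1 + Real.log M) / Qn
        ≤ 16 * ((N : ℝ) + 1) * Real.log N * (1 + Real.log N) / X := by
          gcongr
      _ ≤ 16 * (2 * N) * Real.log N * (2 * Real.log N) / X := by
          gcongr
          · linarith
          · linarith
      _ = 64 * N * Real.log N ^ 2 / X := by ring
      _ ≤ ε₁ * N / Real.log N := by
          rw [div_le_div_iff₀ (by positivity) hlog0]
          -- `64 N log³ N ≤ ε₁ N X`
          have : 64 * L3 ≤ ε₁ * X := by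
            have h := hX64
            rw [div_mul_eq_mul_div, div_le_iff₀ hε₁0] at h
            linarith
          have hL : Real.log N ^ 2 * Real.log N = L3 := by simp only [hL3]; ring
          calc 64 * N * Real.log N ^ 2 * Real.log N = N * (64 * L3) := by rw [← hL]; ring
            _ ≤ N * (ε₁ * X) := mul_le_mul_of_nonneg_left this hN0.le
            _ = ε₁ * N * X := by ring
  -- combine
  have hI := hcN
  -- `I r₀ · ∑ ≥ (1-ε₁) N/log² N · (θ-ε₁) log N`
  have hsum0 : 0 ≤ ∑ q ∈ (Icc 1 M).filter Squarefree, ((q.totient : ℕ) : ℝ)⁻¹ :=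
    Finset.sum_nonneg fun _ _ => by positivity
  have hprod : (1 - ε₁) * N / Real.log N ^ 2 * ((θ - ε₁) * Real.log N) ≤
      (∫ β in Set.Icc (-r₀) r₀, ‖primeSum N β‖ ^ 2) *
        ∑ q ∈ (Icc 1 M).filter Squarefree, ((q.totient : ℕ) : ℝ)⁻¹ := by
    have hθε : 0 ≤ θ - ε₁ ∨ θ - ε₁ < 0 := le_or_gt 0 (θ - ε₁)
    have h1ε : 0 ≤ (1 - ε₁) * N / Real.log N ^ 2 := by
      have : 0 ≤ 1 - ε₁ := by simp only [hε₁]; linarith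
      positivity
    rcases hθε with h | h
    · exact mul_le_mul hI (hlogM.trans hμφ) (by positivity) (le_trans h1ε hI)
    · have : (1 - ε₁) * N / Real.log N ^ 2 * ((θ - ε₁) * Real.log N) ≤ 0 :=
        mul_nonpos_of_nonneg_of_nonpos h1ε (mul_nonpos_of_nonpos_of_nonneg h.le hlog0.le)
      exact this.trans (mul_nonneg (le_trans h1ε hI) hsum0)
  have hid : (1 - ε₁) * N / Real.log N ^ 2 * ((θ - ε₁) * Real.log N) =
      (1 - ε₁) * (θ - ε₁) * N / Real.log N := by field_simp
  rw [hid] at hprod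
  -- final arithmetic: `mAPI0 ≥ (1-ε₁)(θ-ε₁) N/log N - ε₁ N/log N ≥ (θ - 3ε₁) N/log N`
  have hfin : (θ - 3 * ε₁) * N / Real.log N ≤
      majorArcPairIntegral (periodicArcs Pn Qn) N 0 := by
    have h1 : (θ - 3 * ε₁) * N / Real.log N ≤
        (1 - ε₁) * (θ - ε₁) * N / Real.log N - ε₁ * N / Real.log N := by
      rw [div_sub_div_same, div_le_div_iff_of_pos_right hlog0]
      have h0 : (θ - 3 * ε₁) ≤ (1 - ε₁) * (θ - ε₁) - ε₁ := by
        nlinarith [mul_nonneg hε₁0.le (sub_nonneg.2 hθ1), sq_nonneg ε₁]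
      have := mul_le_mul_of_nonneg_right h0 hN0.le
      linarith
    linarith [herr.trans herr2]
  have hNlog : 0 ≤ (N : ℝ) / Real.log N := by positivity
  calc ((oddPrimes N).card : ℝ) - majorArcPairIntegral (periodicArcs Pn Qn) N 0
      ≤ (1 + ε₁) * N / Real.log N - (θ - 3 * ε₁) * N / Real.log N := by linarith
    _ = (1 - θ + 4 * ε₁) * N / Real.log N := by ring
    _ ≤ (1 - θ + ε) * N / Real.log N := by
        rw [mul_div_assoc, mul_div_assoc]
        exact mul_le_mul_of_nonneg_right (by simp only [hε₁]; linarith) hNlog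

end GoldbachLinnik

end Literature.NumberTheory.Sieve
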